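import Mathlib.Analysis.SpecificLimits.Normed
import Mathlib.RingTheory.SimpleRing.Basic
import Literature.Analysis.FunctionSpaces.GuichardetUHF
import Literature.Analysis.FunctionSpaces.GuichardetUHFProofs
import HarnessLib

/-!
# The quasi-local (UHF) algebra on the Guichardet space is simple (Glimm's theorem)

Companion to `Literature.Analysis.FunctionSpaces.GuichardetUHF` and
`Literature.Analysis.FunctionSpaces.GuichardetUHFProofs` (trunk AnalysisL, item P5; notion
`quasi_local_algebra`). The first file builds the quasi-local C⋆-algebra
`𝔄 = quasiLocalAlg d q hstar ⊆ B(𝓗)` of the quantum spin system on `ℤ^d` with `q ≥ 1` states per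
site, `𝓗 = ℓ²(FinSuppConfig d q)` the Guichardet space (von Neumann's incomplete tensor product
`⊗_{x∈ℤ^d} (ℂ^q, e₀)`): the norm closure of the union of the local matrix algebras
`π_Λ(𝔄_Λ)`, `𝔄_Λ = Op ↥Λ q ≅ M_{q^{|Λ|}}(ℂ)`, `π_Λ(A) = A ⊗ 𝟙_{Λᶜ}`. It leaves as the named fact
`Literature.Analysis.FunctionSpaces.isSimpleRing_quasiLocalAlg : Prop` (`IsSimpleRing ↥𝔄`)
**Glimm's theorem**: a UHF algebra is simple. This file proves it:
`Literature.Analysis.FunctionSpaces.isSimpleRing_quasiLocalAlg_holds` (for every `d`, every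
`q ≥ 1` and every witness `hstar` of the standing ⋆-preservation hypothesis of that file), and the
unconditional specialisation `isSimpleRing_quasiLocalAlg_guichardet` with `hstar` supplied by
`localRep_map_star'_holds`.

## The statement and the printed sources

Glimm (1960), Theorem 5.1 (p. 338): *If `𝔄` is a UHF algebra, then `𝔄` is simple.* Glimm's
proof treats an arbitrary proper two-sided ideal `ℑ` (it is contained in a maximal proper
two-sided ideal, which is closed, and the quotient map is isometric on each matrix algebra `𝔐ᵢ`,
hence isometric), so "simple" there means: no two-sided ideals other than `{0}` and `𝔄` — exactly
Mathlib's `IsSimpleRing` (`IsSimpleOrder (TwoSidedIdeal 𝔄)`), which is what the fact states.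
Bratteli–Robinson I, Corollary 2.6.19 (with Proposition 2.6.17 and Corollary 2.6.18, §2.6.3):
a quasi-local algebra all of whose local algebras `𝔄_α` are simple is simple (there "ideal" means
closed two-sided ideal; for a unital C⋆-algebra the two notions of simplicity agree, and the proof
below produces `1` in any nonzero ideal directly). Bratteli–Robinson I, Example 2.6.12: the UHF
algebra of a spin system, `𝔄_Λ = ⊗_{x∈Λ} M_q`, to which Corollary 2.6.19 applies since full matrix
algebras are simple. For `q = 1` the algebra is `ℂ`, for `d = 0` it is `M_q(ℂ)`; the proof below
is uniform in `d ≥ 0`, `q ≥ 1`.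

## The argument formalised here

We do not follow the quotient-norm route of the printed proofs (Mathlib has no C⋆-norm on the
quotient by a closed ideal); instead we run the matrix-unit computation behind
Bratteli–Robinson's Corollary 2.6.18 ((1) ⇒ (2): an element `B` of the ideal with `‖B - 𝟙‖ < 1` is
invertible, so the ideal is everything) directly in the Guichardet representation. Let `I` be a
two-sided ideal of `𝔄` and `x ∈ I`, `x ≠ 0`.

1. Some matrix coefficient of `x` in the product basis is nonzero: `m = ⟪δ_{σ₁}, x δ_{σ₀}⟫ ≠ 0`
   (`exists_apply_single_apply_ne_zero`; if all of them vanish then `x⋆ δ_σ = 0` for all `σ`, so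
   `⟪δ_σ, x ψ⟫ = ⟪x⋆ δ_σ, ψ⟫ = 0` and `x = 0`).
2. Put `ε = |m| / 2`. The strictly local elements are dense (`dense_iUnion_range_localRepCod`,
   with isotony `localRep_compatible_holds`), so `‖x - π_Λ(a)‖ < ε` for some finite `Λ` and
   `a ∈ 𝔄_Λ`; enlarging `Λ` by isotony (`embedOp`) we may assume `Λ ⊇ supp σ₀ ∪ supp σ₁`, so that
   `σᵢ = (τᵢ inside Λ, 0 outside)` for blocks `τ₀, τ₁ : Λ → Fin q`.
3. The coefficient `c = a τ₁ τ₀ = ⟪δ_{σ₁}, π_Λ(a) δ_{σ₀}⟫` (`localRepCLM_single_splice`) satisfies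
   `|c - m| ≤ ‖π_Λ(a) - x‖ < ε`, hence `|c| > ε > 0`.
4. With the matrix units `E_{τ τ'} = π_Λ(e_{τ τ'})` of `𝔄_Λ` (`e_{τ τ'} = Matrix.single τ τ' 1`;
   `E_{τ τ'}⋆ = E_{τ' τ}`, `∑_κ E_{κ τ} E_{τ κ} = ∑_κ E_{κ κ} = 1`), the compression
   `y = ∑_κ E_{κ τ₁} x E_{τ₀ κ}` lies in `I`, while
   `∑_κ E_{κ τ₁} π_Λ(a) E_{τ₀ κ} = π_Λ(∑_κ e_{κ τ₁} a e_{τ₀ κ}) = π_Λ(a τ₁ τ₀ · 1) = c · 1`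
   (`Matrix.single_mul_mul_single`). The compression is a contraction: for families `V_κ, W_κ`
   of operators with `∑_κ V_κ⋆ V_κ = 1 = ∑_κ W_κ⋆ W_κ` one has `‖∑_κ W_κ⋆ z V_κ‖ ≤ ‖z‖`
   (`norm_sum_star_mul_mul_le`: `|⟪φ, ∑ W_κ⋆ z V_κ ψ⟫| ≤ ∑ ‖W_κ φ‖ ‖z‖ ‖V_κ ψ‖ ≤ ‖z‖ ‖φ‖ ‖ψ‖` by
   Cauchy–Schwarz and `∑ ‖V_κ ψ‖² = ‖ψ‖²`). Hence `‖y - c · 1‖ ≤ ‖x - π_Λ(a)‖ < ε < |c|`.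
5. So `u = c⁻¹ y ∈ I` has `‖1 - u‖ < 1` and is invertible in the Banach algebra `𝔄`
   (`Units.oneSub`), whence `1 = u⁻¹ u ∈ I` and `I = ⊤`. Nontriviality of `𝔄`: `1 Ω = Ω ≠ 0`.

## Sources

* J. Glimm, *On a certain class of operator algebras*, Trans. Amer. Math. Soc. 95 (1960)
  318–340, doi:10.1090/s0002-9947-1960-0112057-5: Theorem 5.1 (UHF algebras are simple).
* O. Bratteli, D. W. Robinson, *Operator Algebras and Quantum Statistical Mechanics I* (2nd ed.,
  Springer 1987), §2.6.3: Proposition 2.6.17, Corollary 2.6.18, Corollary 2.6.19 (a quasi-local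
  algebra with simple local algebras is simple); §2.6.1, Example 2.6.12 (UHF algebras of spin
  systems).

## Mathlib search and design notes

* Used from Mathlib: `IsSimpleRing.of_eq_bot_or_eq_top`, `TwoSidedIdeal.one_mem_iff`,
  `TwoSidedIdeal.mem_bot`, `SetLike.exists_of_lt`; `Units.oneSub` (a perturbation of `1` of norm
  `< 1` is a unit in a complete normed ring; `↥𝔄` is a `CStarAlgebra` by
  `StarSubalgebra.cstarAlgebra`, hence `HasSummableGeomSeries`); `Matrix.single`,
  `Matrix.single_mul_mul_single`, `Matrix.single_mul_single_same`, `Matrix.sum_single_one`,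
  `Matrix.sum_single_eq_diagonal`, `Matrix.smul_one_eq_diagonal`, `Matrix.conjTranspose_single`;
  `lp.inner_single_left`, `lp.norm_apply_le_norm`, `lp.norm_single`,
  `ContinuousLinearMap.adjoint_inner_left/right`, `ContinuousLinearMap.star_eq_adjoint`,
  `ContinuousLinearMap.opNorm_le_bound`, `re_inner_le_norm`, `inner_self_eq_norm_sq`,
  `Finset.sum_mul_sq_le_sq_mul_sq` (Cauchy–Schwarz), `Dense.exists_dist_lt`.
  `rg IsSimpleRing Mathlib/Analysis` finds only field-theoretic uses (`WithAbs`, an import in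
  `RCLike.Basic`): no simplicity results for operator algebras; `rg -i "UHF|uniformly
  hyperfinite"` finds nothing; there is no C⋆-norm on quotients by closed ideals.
* From the companion files: `localRepCLM_single_splice` (matrix coefficients on product basis
  vectors), `localRep_compatible_holds` (isotony, needed for density and for enlarging `Λ`),
  `dense_iUnion_range_localRepCod`, `coe_localRepCod_apply`, `norm_vacuumVector`,
  `localRep_map_star'_holds`.
* No definition is added: the matrix units, the compression and the approximant are local terms
  of the proof; the two operator-theoretic lemmas (`sum_norm_sq_apply_of_sum_star_mul_self`,
  `norm_sum_star_mul_mul_le`) are stated for an arbitrary complex Hilbert space.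
* The fact stays a `def … : Prop`; users feed `isSimpleRing_quasiLocalAlg_holds d q hstar`.
  Not here: uniqueness of the trace, Powers' factor-state results, or the classification of UHF
  algebras by supernatural numbers (Glimm 1960 §§1–4).
-/

noncomputable section

open scoped ComplexOrder InnerProductSpace ENNReal

namespace Literature.Analysis.FunctionSpaces

/-! ### Two operator inequalities on a Hilbert space -/

section Compression

variable {ι : Type*} [Fintype ι] {H : Type*} [NormedAddCommGroup H] [InnerProductSpace ℂ H]
  [CompleteSpace H]

/-- If finitely many bounded operators `T_i` on a Hilbert space satisfy `∑_i T_i⋆ T_i = 1`, then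
`∑_i ‖T_i ψ‖² = ‖ψ‖²` for every vector `ψ` (i.e. `ψ ↦ (T_i ψ)_i` is an isometry into `⊕_i H`):
take `re ⟪ψ, · ψ⟫` of the identity. Standard Hilbert-space calculus (used implicitly in
Bratteli–Robinson I, proof of Corollary 2.6.20, for a complete set of matrix units). [folklore] -/
theorem sum_norm_sq_apply_of_sum_star_mul_self (T : ι → H →L[ℂ] H)
    (hT : ∑ i, star (T i) * T i = 1) (ψ : H) : ∑ i, ‖T i ψ‖ ^ 2 = ‖ψ‖ ^ 2 := by
  have h := congrArg (fun S : H →L[ℂ] H => RCLike.re ⟪ψ, S ψ⟫_ℂ) hT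
  simpa only [sum_apply, mul_apply_eq_comp, inner_sum, map_sum,
    one_apply_eq_self, ContinuousLinearMap.star_eq_adjoint,
    ContinuousLinearMap.adjoint_inner_right, inner_self_eq_norm_sq] using h

/-- **Compressions are contractions.** If `∑_i V_i⋆ V_i = 1 = ∑_i W_i⋆ W_i` for finitely many
bounded operators on a Hilbert space, then `‖∑_i W_i⋆ z V_i‖ ≤ ‖z‖` for every bounded `z`
(the map is `z ↦ W⋆ (𝟙 ⊗ z) V` for the isometries `V = (V_i)_i`, `W = (W_i)_i` into `⊕_i H`):
`re ⟪φ, ∑_i W_i⋆ z V_i ψ⟫ = ∑_i re ⟪W_i φ, z V_i ψ⟫ ≤ ‖z‖ ∑_i ‖W_i φ‖ ‖V_i ψ‖ ≤ ‖z‖ ‖φ‖ ‖ψ‖` by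
the Cauchy–Schwarz inequality and `sum_norm_sq_apply_of_sum_star_mul_self`, applied with
`φ = ∑_i W_i⋆ z V_i ψ`. Standard. [folklore] -/
theorem norm_sum_star_mul_mul_le (V W : ι → H →L[ℂ] H) (hV : ∑ i, star (V i) * V i = 1)
    (hW : ∑ i, star (W i) * W i = 1) (z : H →L[ℂ] H) :
    ‖∑ i, star (W i) * z * V i‖ ≤ ‖z‖ := by
  refine ContinuousLinearMap.opNorm_le_bound _ (norm_nonneg _) fun ψ => ?_
  set φ := (∑ i, star (W i) * z * V i) ψ with hφ
  have hCS : ∑ i, ‖W i φ‖ * ‖V i ψ‖ ≤ ‖φ‖ * ‖ψ‖ := by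
    rw [← sq_le_sq₀ (Finset.sum_nonneg fun i _ => mul_nonneg (norm_nonneg _) (norm_nonneg _))
      (mul_nonneg (norm_nonneg _) (norm_nonneg _)), mul_pow,
      ← sum_norm_sq_apply_of_sum_star_mul_self W hW φ,
      ← sum_norm_sq_apply_of_sum_star_mul_self V hV ψ]
    exact Finset.sum_mul_sq_le_sq_mul_sq _ _ _
  have key : ‖φ‖ ^ 2 ≤ ‖z‖ * ‖ψ‖ * ‖φ‖ := by
    calc ‖φ‖ ^ 2 = RCLike.re ⟪φ, φ⟫_ℂ := (inner_self_eq_norm_sq φ).symm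
      _ = RCLike.re ⟪φ, (∑ i, star (W i) * z * V i) ψ⟫_ℂ := rfl
      _ = ∑ i, RCLike.re ⟪W i φ, z (V i ψ)⟫_ℂ := by
          simp only [sum_apply, mul_apply_eq_comp, inner_sum, map_sum,
            ContinuousLinearMap.star_eq_adjoint, ContinuousLinearMap.adjoint_inner_right]
      _ ≤ ∑ i, ‖W i φ‖ * (‖z‖ * ‖V i ψ‖) := Finset.sum_le_sum fun i _ =>
          (re_inner_le_norm _ _).trans
            (mul_le_mul_of_nonneg_left (z.le_opNorm _) (norm_nonneg _))
      _ = ‖z‖ * ∑ i, ‖W i φ‖ * ‖V i ψ‖ := by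
          rw [Finset.mul_sum]
          exact Finset.sum_congr rfl fun i _ => by ring
      _ ≤ ‖z‖ * (‖φ‖ * ‖ψ‖) := mul_le_mul_of_nonneg_left hCS (norm_nonneg z)
      _ = ‖z‖ * ‖ψ‖ * ‖φ‖ := by ring
  by_cases h0 : ‖φ‖ = 0
  · rw [h0]
    exact mul_nonneg (norm_nonneg _) (norm_nonneg _)
  · have hpos : 0 < ‖φ‖ := (norm_nonneg _).lt_of_ne (Ne.symm h0)
    rw [pow_two] at key
    exact le_of_mul_le_mul_right key hpos

end Compression

/-! ### Matrix units on the Guichardet space and the proof of Glimm's theorem -/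

section QLattice

open Literature.Probability.LatticeModels (Site)
open Literature.MathematicalPhysics.QuantumLattice (Op embedOp)

variable {d q : ℕ} [NeZero q]
variable (hstar : localRep_map_star' (d := d) (q := q))

/-- The represented matrix units `E_{τ τ'} = π_Λ(e_{τ τ'})`, `e_{τ τ'} = Matrix.single τ τ' 1`, of
the local algebra `𝔄_Λ` satisfy `E_{τ τ'}⋆ = E_{τ' τ}` (`π_Λ` is a ⋆-homomorphism and
`e_{τ τ'}ᴴ = e_{τ' τ}`). Bratteli–Robinson I, Example 2.6.12 and proof of Corollary 2.6.20
(complete sets of matrix units `{E_{ij}}` of the local algebras).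
[cite: BratteliRobinsonI1987, Example 2.6.12] -/
theorem star_localRep_single (Λ : Finset (Site d)) (τ τ' : ↥Λ → Fin q) :
    star (localRep hstar Λ (Matrix.single τ τ' (1 : ℂ))) =
      localRep hstar Λ (Matrix.single τ' τ (1 : ℂ)) := by
  rw [← map_star, Matrix.star_eq_conjTranspose, Matrix.conjTranspose_single, star_one]

/-- `∑_κ E_{τ₀ κ}⋆ E_{τ₀ κ} = ∑_κ E_{κ τ₀} E_{τ₀ κ} = ∑_κ E_{κ κ} = 1` for the represented matrix
units `E_{τ τ'} = π_Λ(e_{τ τ'})` of `𝔄_Λ` (`π_Λ` is a unital algebra homomorphism).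
Bratteli–Robinson I, Example 2.6.12 and proof of Corollary 2.6.20 (`𝟙 = ∑_i E_{ii}` for a
complete set of matrix units). [cite: BratteliRobinsonI1987, Example 2.6.12] -/
theorem sum_star_localRep_single_mul_self (Λ : Finset (Site d)) (τ₀ : ↥Λ → Fin q) :
    ∑ κ : ↥Λ → Fin q, star (localRep hstar Λ (Matrix.single τ₀ κ (1 : ℂ))) *
        localRep hstar Λ (Matrix.single τ₀ κ (1 : ℂ)) = 1 := by
  simp_rw [star_localRep_single, ← map_mul, Matrix.single_mul_single_same, one_mul]
  rw [← map_sum, Matrix.sum_single_one, map_one]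

/-- **Compression by matrix units extracts a coefficient**: for `a ∈ 𝔄_Λ`,
`∑_κ E_{τ₁ κ}⋆ π_Λ(a) E_{τ₀ κ} = π_Λ(∑_κ e_{κ τ₁} a e_{τ₀ κ}) = π_Λ(a τ₁ τ₀ · 𝟙) = a τ₁ τ₀ · 1`
(`e_{κ τ₁} a e_{τ₀ κ} = a τ₁ τ₀ · e_{κ κ}`, `Matrix.single_mul_mul_single`). This is the matrix
algebra computation behind Bratteli–Robinson I, Corollary 2.6.18 (2) for full matrix algebras
(the ideal generated by a nonzero `a ∈ M_N` contains `𝟙`), cf. Example 2.6.12.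
[cite: BratteliRobinsonI1987, Cor. 2.6.18] -/
theorem sum_star_localRep_single_mul_localRep_mul (Λ : Finset (Site d))
    (τ₀ τ₁ : ↥Λ → Fin q) (a : Op ↥Λ q) :
    ∑ κ : ↥Λ → Fin q, star (localRep hstar Λ (Matrix.single τ₁ κ (1 : ℂ))) *
        localRep hstar Λ a * localRep hstar Λ (Matrix.single τ₀ κ (1 : ℂ)) =
      a τ₁ τ₀ • (1 : GuichardetSpace d q →L[ℂ] GuichardetSpace d q) := by
  simp_rw [star_localRep_single, ← map_mul, Matrix.single_mul_mul_single, one_mul, mul_one]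
  rw [← map_sum, Matrix.sum_single_eq_diagonal (fun _ => a τ₁ τ₀),
    ← Matrix.smul_one_eq_diagonal, map_smul, map_one]

/-- **A nonzero bounded operator on the Guichardet space has a nonzero matrix coefficient in the
product basis**: if `x ≠ 0` then `⟪δ_{σ₁}, x δ_{σ₀}⟫ = (x δ_{σ₀})(σ₁) ≠ 0` for some configurations
`σ₀, σ₁` (`δ_σ = lp.single 2 σ 1`). Contrapositively, if all coefficients vanish then every
`x⋆ δ_{σ₁}` vanishes coordinatewise (`(x⋆ δ_{σ₁})(σ₀) = conj ⟪δ_{σ₁}, x δ_{σ₀}⟫`), so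
`(x ψ)(σ₁) = ⟪δ_{σ₁}, x ψ⟫ = ⟪x⋆ δ_{σ₁}, ψ⟫ = 0` for all `ψ`. Standard (`{δ_σ}` is an orthonormal
basis of `ℓ²`). [folklore] -/
theorem exists_apply_single_apply_ne_zero
    {x : GuichardetSpace d q →L[ℂ] GuichardetSpace d q} (hx : x ≠ 0) :
    ∃ σ₀ σ₁ : FinSuppConfig d q, x (lp.single 2 σ₀ (1 : ℂ)) σ₁ ≠ 0 := by
  by_contra! h
  have hcoord : ∀ (ξ : GuichardetSpace d q) (σ : FinSuppConfig d q),
      (ξ : FinSuppConfig d q → ℂ) σ = ⟪lp.single 2 σ (1 : ℂ), ξ⟫_ℂ := fun ξ σ => by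
    rw [lp.inner_single_left, RCLike.inner_apply, map_one, mul_one]
  have hadj : ∀ σ₁ : FinSuppConfig d q,
      ContinuousLinearMap.adjoint x (lp.single 2 σ₁ (1 : ℂ)) = 0 := fun σ₁ => by
    refine lp.ext (funext fun σ₀ => ?_)
    have h0 : (ContinuousLinearMap.adjoint x (lp.single 2 σ₁ (1 : ℂ)) : FinSuppConfig d q → ℂ)
        σ₀ = 0 := by
      rw [hcoord, ContinuousLinearMap.adjoint_inner_right, ← inner_conj_symm, ← hcoord, h σ₀ σ₁,
        map_zero]
    rw [h0]
    rfl
  apply hx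
  ext ψ σ₁
  have h0 : (x ψ : FinSuppConfig d q → ℂ) σ₁ = 0 := by
    rw [hcoord, ← ContinuousLinearMap.adjoint_inner_left, hadj, inner_zero_left]
  rw [h0]
  rfl

/-- A configuration supported inside the finite region `Λ` is the reference configuration
`σ ≡ 0` with the block `σ|_Λ` spliced into `Λ`: `σ = (σ|_Λ inside Λ, 0 outside)`.
Bratteli–Robinson II §6.2.1 (the factorisation `𝓗 = 𝓗_Λ ⊗ 𝓗_{Λᶜ}` of the product basis).
[folklore] -/
theorem FinSuppConfig.splice_zero_restrict {Λ : Finset (Site d)} {σ : FinSuppConfig d q}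
    (h : ∀ x, σ.1 x ≠ 0 → x ∈ Λ) :
    (0 : FinSuppConfig d q).splice Λ (σ.restrict Λ) = σ := by
  refine FinSuppConfig.ext fun x => ?_
  rw [FinSuppConfig.splice_apply]
  split_ifs with hx
  · rfl
  · change (0 : Fin q) = σ.1 x
    by_contra hne
    exact hx (h x (Ne.symm hne))

/-- Matrix coefficients are bounded by the operator norm: `|(T δ_{σ₀})(σ₁)| ≤ ‖T δ_{σ₀}‖ ≤ ‖T‖`
for the product basis vectors `δ_σ = lp.single 2 σ 1` (`‖δ_σ‖ = 1`) of the Guichardet space.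
Standard. [folklore] -/
theorem norm_apply_single_apply_le (T : GuichardetSpace d q →L[ℂ] GuichardetSpace d q)
    (σ₀ σ₁ : FinSuppConfig d q) : ‖T (lp.single 2 σ₀ (1 : ℂ)) σ₁‖ ≤ ‖T‖ := by
  have h1 : ‖T (lp.single 2 σ₀ (1 : ℂ)) σ₁‖ ≤ ‖T (lp.single 2 σ₀ (1 : ℂ))‖ :=
    lp.norm_apply_le_norm two_ne_zero _ _
  have h2 : ‖T (lp.single 2 σ₀ (1 : ℂ))‖ ≤
      ‖T‖ * ‖(lp.single 2 σ₀ (1 : ℂ) : GuichardetSpace d q)‖ :=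
    T.le_opNorm _
  rw [lp.norm_single (by norm_num : (0 : ℝ≥0∞) < 2), norm_one, mul_one] at h2
  exact h1.trans h2

variable (d q) in
/-- **Glimm's theorem: the quasi-local (UHF) algebra `𝔄` on the Guichardet space is simple**
(discharge of the named fact `isSimpleRing_quasiLocalAlg`): `𝔄 = quasiLocalAlg d q hstar`, the
norm closure in `B(ℓ²(FinSuppConfig d q))` of the union of the local matrix algebras
`π_Λ(𝔄_Λ)`, has no two-sided ideals other than `⊥` and `⊤` (Mathlib `IsSimpleRing`), for every
`d`, every `q ≥ 1` and every witness `hstar` of the ⋆-preservation hypothesis. Glimm (1960),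
Theorem 5.1: a UHF algebra is simple (no proper nonzero two-sided ideals);
Bratteli–Robinson I, Corollary 2.6.19 (a quasi-local algebra with simple local algebras `𝔄_α`
is simple) with Proposition 2.6.17, Corollary 2.6.18 and Example 2.6.12 (UHF algebras: the
`𝔄_Λ` are full matrix algebras). Proof (see the module docstring): a nonzero `x` in a two-sided
ideal `I` has a nonzero matrix coefficient `m = ⟪δ_{σ₁}, x δ_{σ₀}⟫`; approximate `x` within
`|m|/2` by a strictly local `π_Λ(a)` with `Λ ⊇ supp σ₀ ∪ supp σ₁`; the compression
`∑_κ E_{κ τ₁} x E_{τ₀ κ} ∈ I` by the matrix units of `𝔄_Λ` is then within `|m|/2` of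
`a τ₁ τ₀ · 1` with `|a τ₁ τ₀| > |m|/2`, hence invertible, so `1 ∈ I`. [cite: Glimm1960, Thm. 5.1] -/
theorem isSimpleRing_quasiLocalAlg_holds : isSimpleRing_quasiLocalAlg d q hstar := by
  unfold isSimpleRing_quasiLocalAlg
  -- `𝔄` is nontrivial: `1 ≠ 0` since `1 Ω = Ω` has norm `1`
  haveI : Nontrivial ↥(quasiLocalAlg d q hstar) := ⟨⟨0, 1, fun h => by
    have h' := congrArg (fun T : ↥(quasiLocalAlg d q hstar) =>
      ‖(T : GuichardetSpace d q →L[ℂ] GuichardetSpace d q) (vacuumVector d q)‖) h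
    simp only [ZeroMemClass.coe_zero, OneMemClass.coe_one, zero_apply,
      one_apply_eq_self, norm_zero, norm_vacuumVector] at h'
    exact zero_ne_one h'⟩⟩
  refine IsSimpleRing.of_eq_bot_or_eq_top fun I => ?_
  rw [or_iff_not_imp_left, ← I.one_mem_iff]
  intro hI
  obtain ⟨x, hxI, hx0⟩ := SetLike.exists_of_lt (bot_lt_iff_ne_bot.mpr hI : ⊥ < I)
  have hx0' : (x : GuichardetSpace d q →L[ℂ] GuichardetSpace d q) ≠ 0 := fun h =>
    hx0 ((TwoSidedIdeal.mem_bot _).mpr (ZeroMemClass.coe_eq_zero.mp h))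
  -- Step 1: a nonzero matrix coefficient `m = ⟪δ_σ₁, x δ_σ₀⟫` in the product basis
  obtain ⟨σ₀, σ₁, hm⟩ := exists_apply_single_apply_ne_zero hx0'
  have hε : 0 < ‖(x : GuichardetSpace d q →L[ℂ] GuichardetSpace d q)
      (lp.single 2 σ₀ (1 : ℂ)) σ₁‖ / 2 :=
    half_pos (norm_pos_iff.mpr hm)
  -- Step 2: a strictly local approximant `π_Λ(a)` of `x` within `ε = ‖m‖ / 2`, the finite
  -- region `Λ` enlarged (isotony) so as to contain the supports of `σ₀` and `σ₁`
  obtain ⟨y, hy, hxy⟩ :=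
    (dense_iUnion_range_localRepCod d q hstar localRep_compatible_holds).exists_dist_lt x hε
  obtain ⟨Λ', ⟨a', rfl⟩⟩ := Set.mem_iUnion.1 hy
  obtain ⟨Λ, hΛ', h0Λ, h1Λ⟩ : ∃ Λ : Finset (Site d), Λ' ⊆ Λ ∧ (∀ z, σ₀.1 z ≠ 0 → z ∈ Λ) ∧
      (∀ z, σ₁.1 z ≠ 0 → z ∈ Λ) :=
    ⟨Λ' ∪ (σ₀.2.toFinset ∪ σ₁.2.toFinset), Finset.subset_union_left,
      fun z hz => by simp [hz], fun z hz => by simp [hz]⟩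
  obtain ⟨a, ha⟩ : ∃ a : Op ↥Λ q, localRepCLM Λ' a' = localRepCLM Λ a :=
    ⟨embedOp hΛ' a', (localRep_compatible_holds hΛ' a').symm⟩
  obtain ⟨τ₀, rfl⟩ : ∃ τ₀ : ↥Λ → Fin q, (0 : FinSuppConfig d q).splice Λ τ₀ = σ₀ :=
    ⟨_, FinSuppConfig.splice_zero_restrict h0Λ⟩
  obtain ⟨τ₁, rfl⟩ : ∃ τ₁ : ↥Λ → Fin q, (0 : FinSuppConfig d q).splice Λ τ₁ = σ₁ :=
    ⟨_, FinSuppConfig.splice_zero_restrict h1Λ⟩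
  clear h0Λ h1Λ hy
  set X : GuichardetSpace d q →L[ℂ] GuichardetSpace d q := ↑x with hX
  set m : ℂ := X (lp.single 2 ((0 : FinSuppConfig d q).splice Λ τ₀) (1 : ℂ))
    ((0 : FinSuppConfig d q).splice Λ τ₁) with hm_def
  set ε : ℝ := ‖m‖ / 2 with hε_def
  have hdist : ‖X - localRepCLM Λ a‖ < ε := by
    rw [← ha]
    rwa [dist_eq_norm] at hxy
  -- Step 3: the matrix coefficient `c = a τ₁ τ₀ = ⟪δ_σ₁, π_Λ(a) δ_σ₀⟫` is within `ε` of `m`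
  set c : ℂ := a τ₁ τ₀ with hc_def
  have hc : c = localRepCLM Λ a (lp.single 2 ((0 : FinSuppConfig d q).splice Λ τ₀) (1 : ℂ))
      ((0 : FinSuppConfig d q).splice Λ τ₁) := (localRepCLM_single_splice Λ a τ₀ τ₁).symm
  have hcm : ‖c - m‖ < ε := by
    have hsub : c - m = (localRepCLM Λ a - X)
        (lp.single 2 ((0 : FinSuppConfig d q).splice Λ τ₀) (1 : ℂ))
        ((0 : FinSuppConfig d q).splice Λ τ₁) := by
      rw [hc, sub_apply, lp.coeFn_sub, Pi.sub_apply]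
    rw [hsub]
    exact (norm_apply_single_apply_le _ _ _).trans_lt (by rwa [← norm_sub_rev])
  have hεc : ε < ‖c‖ := by
    have h1 : ‖m‖ - ‖c‖ ≤ ‖m - c‖ := norm_sub_norm_le m c
    rw [← norm_sub_rev] at hcm
    rw [hε_def] at hcm ⊢
    linarith
  have hc0 : c ≠ 0 := fun h => by
    rw [h, norm_zero] at hεc
    exact absurd (hε.trans hεc) (lt_irrefl 0)
  -- Step 4: the compression `y = ∑_κ E_{κ τ₁} x E_{τ₀ κ}` lies in `I` and is within `ε` of
  -- `c • 1 = ∑_κ E_{κ τ₁} π_Λ(a) E_{τ₀ κ}`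
  set yI : ↥(quasiLocalAlg d q hstar) :=
    ∑ κ : ↥Λ → Fin q, star (localRepCod hstar Λ (Matrix.single τ₁ κ (1 : ℂ))) * x *
      localRepCod hstar Λ (Matrix.single τ₀ κ (1 : ℂ)) with hyI
  have hyI_mem : yI ∈ I :=
    sum_mem fun κ _ => I.mul_mem_right _ _ (I.mul_mem_left _ _ hxI)
  have hcoe_yI : (yI : GuichardetSpace d q →L[ℂ] GuichardetSpace d q) =
      ∑ κ : ↥Λ → Fin q, star (localRep hstar Λ (Matrix.single τ₁ κ (1 : ℂ))) * X *
        localRep hstar Λ (Matrix.single τ₀ κ (1 : ℂ)) := by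
    simp only [hyI, AddSubmonoidClass.coe_finsetSum, MulMemClass.coe_mul, StarMemClass.coe_star,
      coe_localRepCod_apply, hX]
  have hbound : ‖(yI : GuichardetSpace d q →L[ℂ] GuichardetSpace d q) - c • 1‖ < ε := by
    rw [hcoe_yI, ← sum_star_localRep_single_mul_localRep_mul hstar Λ τ₀ τ₁ a,
      ← Finset.sum_sub_distrib]
    simp_rw [← sub_mul, ← mul_sub]
    exact (norm_sum_star_mul_mul_le _ _ (sum_star_localRep_single_mul_self hstar Λ τ₀)
      (sum_star_localRep_single_mul_self hstar Λ τ₁) _).trans_lt hdist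
  -- Step 5: `u = c⁻¹ y ∈ I` is within distance `1` of `1`, hence a unit, so `1 ∈ I`
  have hu_mem : c⁻¹ • yI ∈ I := by
    rw [Algebra.smul_def]
    exact I.mul_mem_left _ _ hyI_mem
  have hu : ‖(1 : ↥(quasiLocalAlg d q hstar)) - c⁻¹ • yI‖ < 1 := by
    have h1 : (1 : ↥(quasiLocalAlg d q hstar)) - c⁻¹ • yI = c⁻¹ • (c • 1 - yI) := by
      rw [smul_sub, smul_smul, inv_mul_cancel₀ hc0, one_smul]
    have h2 : ‖c • (1 : ↥(quasiLocalAlg d q hstar)) - yI‖ =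
        ‖(yI : GuichardetSpace d q →L[ℂ] GuichardetSpace d q) - c • 1‖ := by
      rw [← norm_sub_rev]
      rfl
    rw [h1, norm_smul, norm_inv, h2, inv_mul_lt_iff₀ (norm_pos_iff.mpr hc0), mul_one]
    exact hbound.trans hεc
  obtain ⟨u, hu_eq⟩ : IsUnit (c⁻¹ • yI) := by
    have h := (Units.oneSub ((1 : ↥(quasiLocalAlg d q hstar)) - c⁻¹ • yI) hu).isUnit
    rwa [Units.val_oneSub, sub_sub_cancel] at h
  have h1 := I.mul_mem_left (↑u⁻¹ : ↥(quasiLocalAlg d q hstar)) _ hu_mem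
  rwa [← hu_eq, Units.inv_mul] at h1

variable (d q) in
/-- **The concrete UHF algebra of the spin system is simple, unconditionally**: Glimm's theorem
`isSimpleRing_quasiLocalAlg_holds` with the ⋆-preservation hypothesis `hstar` supplied by
`localRep_map_star'_holds`. Glimm (1960), Theorem 5.1; Bratteli–Robinson I, Corollary 2.6.19,
Example 2.6.12. [cite: Glimm1960, Thm. 5.1] -/
theorem isSimpleRing_quasiLocalAlg_guichardet :
    IsSimpleRing ↥(quasiLocalAlg d q (localRep_map_star'_holds (d := d) (q := q))) :=
  isSimpleRing_quasiLocalAlg_holds d q _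

end QLattice

end Literature.Analysis.FunctionSpaces
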